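import Literature.MathematicalPhysics.QuantumFieldTheory.Balaban1983to89.B11Thm1CarrierT
import Literature.MathematicalPhysics.QuantumFieldTheory.Balaban1983to89.B11Thm1LevelZero

/-!
# `Balaban1983to89.B11Thm1CarrierTLevelZero` — [Balaban1985Variational] Theorem 1 p. 279 at the socket `B11Thm1CarrierT.varProblemT F N K 0 R`
# (the Theorem-1 carrier READ AT NODE 00's objects), LEVEL `k = 0`: the existence clause (8) and the uniqueness clause (6) HOLD OUTRIGHT with `B₃ = 7`
# (`d = 4`) for every boundary datum satisfying (7) — the non-vacuous trivial member of the pin's Theorem-1 family; the regularity clause (9)–(10) reads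
# the residual data `R` and is not touched

T. Bałaban, *The variational problem and background fields in renormalization group method for lattice gauge theories*, Commun. Math. Phys. **102**
(1985) 277–309 [Balaban1985Variational], Theorem 1 p. 279 with (2), (6), (7), (8) p. 278.  Seat `pub-ymgap-dag-n07-a` (gen 2; YM-PLAN Track A, HUMAN RULING
D-0062, KNIT-BY-NAME seat of node N07); composition BY NAME of the seat's `B11Thm1CarrierT` (p417210: `varProblemT`, `exists8_iff`, `unique6_iff`) and
`B11Thm1LevelZero` (`isBackground_zero_iff`, `inUkClassB11_zero_of_plaqSmall`).  THEOREMS ONLY (0 `def`, 0 `sorry`, standard axioms).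

WHAT IS PROVED.  `inUkClassB11_mono` (the (2)-class grows with `ε₀`, `B10Eq68TorusRegularity.InSpaceA.mono_eps`); `onMinimalOrbit_levelZero_iff` (at level 0
«minimal orbit in `𝔘_0(e) ∩ 𝔅_0(V)`» IS «`U = V ∈ 𝔘_0(e)`»); **`exists8_levelZero`** ((8) at the socket, level 0, `B₃ = 7`: the minimiser is `V`);
**`unique6_levelZero`** ((6) in the declared reading D-n07a-1, level 0, `B₃ = 7`, every `a₀`); `exists8_and_unique6_levelZero` (both, = `B11Thm1.Thm1At` at level 0
minus the regularity clause, which reads `R`).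

HONEST FRAMING: count-neutral; the TRIVIAL level only (`Ū^0 = U`); N07 NOT discharged — its Theorem-1 slot quantifies over ALL levels with uniform constants and
the levels `k ≥ 1` are Bałaban's theorem, proved nowhere in the tree; nothing of the induction claimed; one finite four-torus programme at fixed `ε`; nothing
continuum ∕ ℝ⁴ ∕ OS ∕ mass-gap ∕ Clay.
-/

noncomputable section

open scoped Matrix.Norms.L2Operator

namespace Literature.MathematicalPhysics.QuantumFieldTheory.Balaban1983to89.B11Thm1CarrierTLevelZero

open T4Continuum (T4Family)
open B12GaugeOrbits021 (OrbitRel)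
open Node00 (SU avOfRecord InUkClassB11)
open B11Thm1 (Exists8 Unique6)
open B11Thm1CarrierT (RegCarrierT varProblemT exists8_iff unique6_iff onMinimalOrbit_iff)
open B11Thm1LevelZero (isBackground_zero_iff inUkClassB11_zero_of_plaqSmall)

variable {F : T4Family} {N : ℕ} [NeZero N]

omit [NeZero N] in
/-- **The (2)-class grows with its radius** (`η_k ≥ 0`; `B10Eq68TorusRegularity.InSpaceA.mono_eps` BY NAME). [cite: Balaban1985Variational, (2) p.278 («(2) are strict upper bounds»)] -/
theorem inUkClassB11_mono {K k : ℕ} {ε₀ ε₀' : ℝ} (hε : ε₀ ≤ ε₀') {U : GaugeField (F.P K) 0 (SU N)} (h : InUkClassB11 F N K k ε₀ U) :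
    InUkClassB11 F N K k ε₀' U :=
  B10Eq68TorusRegularity.InSpaceA.mono_eps hε (pow_nonneg (inv_nonneg.mpr (Nat.cast_nonneg _)) k) h

/-- **At level 0 a minimal configuration IS the datum**: «U lies on a minimal orbit of (5) in `𝔘_0(e) ∩ 𝔅_0(V)`» ⇔ `U = V ∧ V ∈ 𝔘_0(e)` (`Ū^0 = U`).
[cite: Balaban1985Variational, (3), (5)–(6) p.278 (`k = 0`)] -/
theorem onMinimalOrbit_levelZero_iff {K : ℕ} (R : RegCarrierT F N K) (e : ℝ) (V U : GaugeField (F.P K) 0 (SU N)) :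
    (varProblemT F N K 0 R).OnMinimalOrbit e V U ↔ U = V ∧ InUkClassB11 F N K 0 e U :=
  (onMinimalOrbit_iff R e V U).trans (isBackground_zero_iff _ _ V U)

/-- **(8) AT THE SOCKET, LEVEL 0** (`B₃ = 7`, `d = 4`): for `0 < ε₁` and `|V(∂p) − 1| < ε₁`, a minimal configuration in `𝔘_0(7ε₁) ∩ 𝔅_0(V)` exists — `V`
itself (`B11Thm1LevelZero.inUkClassB11_zero_of_plaqSmall`). [cite: Balaban1985Variational, Thm 1 (8) p.279 (`k = 0`)] -/
theorem exists8_levelZero (K : ℕ) (R : RegCarrierT F N K) {ε₁ : ℝ} (hε₁ : 0 < ε₁) (V : GaugeField (F.P K) 0 (SU N)) (hV : PlaqSmall ε₁ V) :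
    Exists8 (varProblemT F N K 0 R) 7 ε₁ V :=
  (exists8_iff R 7 ε₁ V).2 ⟨V, (isBackground_zero_iff _ _ V V).2 ⟨rfl, inUkClassB11_zero_of_plaqSmall F N K hε₁ hV⟩⟩

/-- **(6) AT THE SOCKET, LEVEL 0** (declared reading D-n07a-1; `B₃ = 7`, every `a₀`): for `7ε₁ ≤ ε₀ ≤ a₀` the level-0 minimal configuration (`= V`) lies in
`𝔘_0(ε₀)` and every minimiser over `𝔘_0(ε₀) ∩ 𝔅_0(V)` (`= V`) is on its residual orbit. [cite: Balaban1985Variational, Thm 1 p.279 («unique critical orbit in the space (6)», `k = 0`)] -/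
theorem unique6_levelZero (K : ℕ) (R : RegCarrierT F N K) (a₀ : ℝ) {ε₁ : ℝ} (hε₁ : 0 < ε₁) (V : GaugeField (F.P K) 0 (SU N))
    (hV : PlaqSmall ε₁ V) : Unique6 (varProblemT F N K 0 R) a₀ 7 ε₁ V := by
  rw [unique6_iff]
  intro ε₀ hlo _ U hU
  obtain ⟨rfl, -⟩ := (isBackground_zero_iff _ _ V U).1 hU
  refine ⟨inUkClassB11_mono hlo (inUkClassB11_zero_of_plaqSmall F N K hε₁ hV), rfl, fun U' hU' => ?_⟩
  obtain ⟨rfl, -⟩ := (isBackground_zero_iff _ _ _ U').1 hU'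
  exact OrbitRel.refl 0 _

/-- **(8) ∧ (6) at the socket, level 0** — `B11Thm1.Thm1At` at level 0 minus the regularity clause (which reads the residual data `R`).
[cite: Balaban1985Variational, Thm 1 p.279 (`k = 0`)] -/
theorem exists8_and_unique6_levelZero (K : ℕ) (R : RegCarrierT F N K) (a₀ : ℝ) {ε₁ : ℝ} (hε₁ : 0 < ε₁) (V : GaugeField (F.P K) 0 (SU N))
    (hV : (varProblemT F N K 0 R).Reg7 ε₁ V) :
    Exists8 (varProblemT F N K 0 R) 7 ε₁ V ∧ Unique6 (varProblemT F N K 0 R) a₀ 7 ε₁ V :=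
  ⟨exists8_levelZero K R hε₁ V hV, unique6_levelZero K R a₀ hε₁ V hV⟩

end Literature.MathematicalPhysics.QuantumFieldTheory.Balaban1983to89.B11Thm1CarrierTLevelZero
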